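import Summits.HodgeConjecture.CorCM.Census.IcosicDihedralGrowth

/-!
# Icosic atlas, type `D₁₀` (third sequel): the lattice theorem `H = P ⊔ A` — the translates of the fifty-one rank-four faces generate the Hodge lattice of the
# whole `F`-slice modulo divisors (kernel census; `μ(D₁₀) ≤ 66`, hence **`μ(D₁₀) = 66` EXACTLY** with `Census/IcosicDihedralMinimality.lean`)

COR-CM (cell `pub-hodgecm2`), count-neutral kernel census by the literature seat lit-andre-3 (gen 15; claim ICOSIC-ATLAS; cell memo
`HOME/pub-hodgecm2-lit-andre-3/PORTFOLIO-lit-andre-3-g15.md`), third sequel of `Census/IcosicDihedralSpecies.lean` (imports `Census/IcosicDihedralGrowth.lean`); method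
VERBATIM `Census/IcosicSplitLattice.lean`: **`H ⊓ X_R ≤ P ⊔ A`** (`hodge_inf_XR_le`) by a UNIMODULAR CERTIFICATE (`cert_spec`, `rowV_spec`) — five translates of
the internal face `0` in pair coordinates (`R`, entries `0, ±1`), an integer inverse `U` on `5` pivot pairs (entries in `[−1, 1]`), Hodge for the ten Pohlmann
forms `τ_i ∈ {r 0..4, sr 0..4}`, an integer adjugate certificate `adj · M = 512 · 1` on the ten other pairs (`det = −2⁹`); then the modular law elementwise
(**`lattice_theorem_icosic_dihedral`**) and, with `sixtysix_le_card_of_generates`, **`deficiency_sixtysix_dihedral`**: `μ(D₁₀) = μ_faces = 66 = #blocks − 2 =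
dim_{𝔽₂}(H/P ⊗ 𝔽₂)_G`.  All tables produced and re-verified by `scratch/leandata_d10.py`.
No named fact, no `sorry`.  HC_CM is not proved anywhere in this cell; nothing here is a headline.

## References
* [Pohlmann1968] H. Pohlmann, Algebraic cycles on abelian varieties of complex multiplication type, Ann. of Math. 88 (1968), Thm 1.
* [Milne1999] J. S. Milne, Lefschetz motives and the Tate conjecture, Compositio Math. 117 (1999), Prop. 2.1, p. 54.
-/

namespace Summit.HodgeConjecture.CorCM.Census.IcosicDihedralSpecies

open Finset DihedralGroup

/-! ## `H ⊓ X_R ≤ P ⊔ A`: the unimodular certificate of the exceptional set -/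

/-- The ten Pohlmann forms `τ_i ∈ {r 0, …, r 4, sr 0, …, sr 4}` (a transversal of `G/⟨c⟩`; the other ten forms are their negatives). [folklore] -/
def tau (i : Fin 10) : G := if i.val < 5 then r ((i.val : ℕ) : ZMod 10) else sr (((i.val - 5 : ℕ) : ℕ) : ZMod 10)

/-- The faces of the five certificate rows (internal face `0`). [folklore] -/
def rk : Fin 5 → Fin 66 := ![0, 0, 0, 0, 0]

/-- The translations of the five certificate rows. [folklore] -/
def rg : Fin 5 → G :=
  ![r 0, r 1, r 2, r 3, r 4]

set_option maxRecDepth 100000 in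
/-- The certificate rows in pair coordinates, packed two bits per entry (`entry + 1`): `R i r = [rep r ∈ face_i] − [c · rep r ∈ face_i]` where
`face_i` = the translate of face `rk i` by `rg i` (identified with `rowV i` by `rowV_spec`). [folklore] -/
def Rcode : Fin 5 → ℕ :=
  ![358957398, 362087769, 374609253, 424695189, 626088533]

/-- Row `i`, pair coordinate `r` (an integer in `{−1, 0, 1}`). [folklore] -/
def R (i : Fin 5) (r : Fin 15) : ℤ := (((Rcode i >>> (2 * r.val)) % 4 : ℕ) : ℤ) - 1

/-- The pair corrections of row `i`: the representatives of the non-representative labels of `face_i`. [folklore] -/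
def pc : Fin 5 → Finset Pt :=
  ![{t 1 1, t 1 0}, {t 1 2, t 1 1}, {t 1 3, t 1 2}, {t 1 4, t 1 3}, {t 1 4}]

/-- The five pivot pairs. [folklore] -/
def piv : Fin 5 → Fin 15 := ![4, 5, 6, 8, 9]

/-- The ten non-pivot pairs. [folklore] -/
def nonpiv : Fin 10 → Fin 15 := ![0, 1, 2, 3, 7, 10, 11, 12, 13, 14]

set_option maxRecDepth 100000 in
/-- The integer inverse of `R` on the pivots, packed four bits per entry (`entry + 8`): `Σ_t U i t · R t (piv j) = δ_ij`. [folklore] -/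
def Ucode : Fin 5 → ℕ :=
  ![620921, 559255, 559224, 558984, 555400]

/-- `U i j` (an integer in `[−2, 2]`). [folklore] -/
def U (i j : Fin 5) : ℤ := (((Ucode i >>> (4 * j.val)) % 16 : ℕ) : ℤ) - 8

/-- Integer adjugate certificate of the `10 × 10` Pohlmann sign matrix on the non-pivot pairs: `adj · M = 512 · 1` (`det M = −2⁹`). [folklore] -/
def adj : Fin 10 → Fin 10 → ℤ :=
  ![![0, 256, 0, 0, 0, 256, 0, 0, 0, 0], ![256, -256, 0, 0, 0, -256, 0, 0, 0, -256], ![0, 0, 256, -256, 0, 0, 256, -256, 0, 0], ![0, 0, -256, 0, 0, 0, -256, 0, 0, 0], ![-256, 256, -256, 256, -256, 256, -256, 256, -256, 256],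
    ![-256, 256, 0, 0, 0, 0, 0, 0, 0, 0], ![256, -256, 0, 0, 256, -256, 0, 0, 0, 0], ![0, 0, 256, 0, 0, 0, 256, -256, 256, 0], ![0, 0, 0, 0, 0, 0, -256, 256, 0, 0], ![0, 256, 0, 0, 0, 0, 256, 0, 0, 0]]

set_option maxRecDepth 100000 in set_option maxHeartbeats 4000000 in set_option synthInstance.maxHeartbeats 400000 in
/-- **Unimodular certificate of `X`**: `U · R_piv = 1`; the rows are Hodge in pair coordinates (`M · Rᵀ = 0`); `adj · M_nonpiv = 512 · 1`; pivots and
non-pivots partition the `42` pairs. [folklore] -/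
theorem cert_spec : (∀ i j : Fin 5, ∑ t : Fin 5, U i t * R t (piv j) = if i = j then 1 else 0) ∧
    (∀ i : Fin 5, ∀ t : Fin 10, ∑ r : Fin 15, hodgeVec (tau t) (rep r) * R i r = 0) ∧
    (∀ a b : Fin 10, ∑ t : Fin 10, adj a t * hodgeVec (tau t) (rep (nonpiv b)) = if a = b then 512 else 0) ∧
    (∀ r : Fin 15, (∃ j : Fin 5, piv j = r) ∨ ∃ b : Fin 10, nonpiv b = r) ∧
    (∀ j : Fin 5, ∀ b : Fin 10, piv j ≠ nonpiv b) ∧ (∀ a b : Fin 10, nonpiv a = nonpiv b → a = b) := by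
  refine ⟨by decide +kernel, by decide +kernel, by decide +kernel, by decide +kernel, by decide +kernel, by decide +kernel⟩

/-- Row `i` of the certificate as a lattice vector: the translate of face `rk i` by `rg i` minus the pairs through its non-representative labels
(manifestly in `P ⊔ A`; `rowV_spec` identifies its values on the representatives with the table `R`). [folklore] -/
def rowV (i : Fin 5) : Pt → ℤ := transl (rg i) (atomVec (rk i)) - ∑ x ∈ pc i, pairVec x

/-- The certificate rows lie in `P ⊔ A`. [folklore] -/
theorem rowV_mem (i : Fin 5) : rowV i ∈ pairs ⊔ atoms :=
  Submodule.sub_mem _ (Submodule.mem_sup_right (Submodule.subset_span ⟨(rg i, rk i), rfl⟩))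
    (Submodule.mem_sup_left (Submodule.sum_mem _ fun x _ => Submodule.subset_span ⟨x, rfl⟩))

/-- Boolean test: is the label one of the `15` representatives `rep`? [folklore] -/
def isRep : Pt → Bool
  | Sum.inr (Sum.inl (b, u)) => decide (u.val < 5) && (decide (b = xT 0) || decide (b = xT 1) || decide (b = xT 2))
  | _ => false

set_option maxRecDepth 100000 in set_option maxHeartbeats 4000000 in set_option synthInstance.maxHeartbeats 400000 in
/-- **Row certificate**: on the representatives the rows take the values `R`, on the other labels of `X` they vanish (the pair corrections cancel the
conjugate labels); `isRep` recognises exactly the representatives, which are pairwise distinct; the pair corrections and the internal faces live on `X`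
(step `0`). [folklore] -/
theorem rowV_spec : (∀ i : Fin 5, ∀ r : Fin 15, rowV i (rep r) = R i r) ∧ (∀ i : Fin 5, ∀ p : XIdx, isRep (xlab p) = false → rowV i (xlab p) = 0) ∧
    (∀ z : Pt, isRep z = true → ∃ r : Fin 15, rep r = z) ∧ (∀ r : Fin 15, isRep (rep r) = true) ∧ (∀ r r' : Fin 15, rep r = rep r' → r = r') ∧
    (∀ i : Fin 5, ((pc i).filter fun x => ¬ rank.getD (blockOf x) 0 = 0).card = 0) ∧
    (∀ i : Fin 5, ((orbitRep (rk i)).filter fun x => ¬ rank.getD (blockOf x) 0 = 0).card = 0) := by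
  refine ⟨by decide +kernel, by decide +kernel, by decide +kernel, by decide +kernel, by decide +kernel, by decide +kernel, by decide +kernel⟩

/-- Off the representatives the rows vanish: on `X` by `rowV_spec`, outside `X` because the internal faces and the pair corrections live on `X`,
a union of blocks. [folklore] -/
theorem rowV_eq_zero (i : Fin 5) {z : Pt} (hz : isRep z = false) : rowV i z = 0 := by
  obtain ⟨-, hX, -, -, -, hpc, hface⟩ := rowV_spec
  by_cases hr : rank.getD (blockOf z) 0 = 0
  · obtain ⟨p, rfl⟩ := xlab_spec.2 z hr
    exact hX i p hz
  · show transl (rg i) (atomVec (rk i)) z - (∑ x ∈ pc i, pairVec x) z = 0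
    rw [Finset.sum_apply]
    have h1 : transl (rg i) (atomVec (rk i)) z = 0 := by
      show (if act (rg i)⁻¹ z ∈ orbitRep (rk i) then (1 : ℤ) else 0) = 0
      rw [if_neg]
      intro hmem
      have h0 := not_not.mp (Finset.filter_eq_empty_iff.mp (Finset.card_eq_zero.mp (hface i)) hmem)
      rw [blockOf_act] at h0
      exact hr h0
    have h2 : ∀ x ∈ pc i, pairVec x z = 0 := by
      intro x hx
      have hx0 := not_not.mp (Finset.filter_eq_empty_iff.mp (Finset.card_eq_zero.mp (hpc i)) hx)
      show (if z ∈ ({x, act cc x} : Finset Pt) then (1 : ℤ) else 0) = 0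
      rw [if_neg]
      intro hzx
      rcases Finset.mem_insert.mp hzx with hzx' | hzx'
      · rw [hzx'] at hr
        exact hr hx0
      · rw [Finset.mem_singleton] at hzx'
        rw [hzx', blockOf_act] at hr
        exact hr hx0
    rw [h1, Finset.sum_eq_zero h2, sub_zero]

/-- **`H ⊓ X_R ≤ P ⊔ A`**: a Hodge vector supported on the representatives of `X` is an integer combination of the certificate rows. [folklore] -/
theorem hodge_inf_XR_le {v : Pt → ℤ} (hH : v ∈ (hodgeLattice : Submodule ℤ (Pt → ℤ))) (hX : v ∈ XR) : v ∈ pairs ⊔ atoms := by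
  obtain ⟨hUR, hMR, hadj, hpart, hdisj, hinj⟩ := cert_spec
  obtain ⟨c, rfl⟩ := (Submodule.mem_span_range_iff_exists_fun ℤ).mp hX
  -- the Pohlmann forms of the combination
  have hform : ∀ t : Fin 10, ∑ r : Fin 15, hodgeVec (tau t) (rep r) * c r = 0 := by
    intro t
    have h := hH (tau t)
    rw [dotProduct_sum] at h
    simp only [dotProduct_smul, dotProduct_ind, Finset.sum_singleton, smul_eq_mul] at h
    rw [← h]
    exact Finset.sum_congr rfl fun r _ => mul_comm _ _
  -- coefficients on the rows (solved on the pivots) and the remainder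
  obtain ⟨y, hy⟩ : ∃ y : Fin 5 → ℤ, ∀ i, y i = ∑ j : Fin 5, c (piv j) * U j i := ⟨_, fun _ => rfl⟩
  obtain ⟨w, hw⟩ : ∃ w : Fin 15 → ℤ, ∀ r, w r = c r - ∑ i : Fin 5, y i * R i r := ⟨_, fun _ => rfl⟩
  have hw_piv : ∀ j : Fin 5, w (piv j) = 0 := by
    intro j
    have e1' : ∀ j' : Fin 5, ∑ i : Fin 5, c (piv j') * U j' i * R i (piv j) = c (piv j') * (if j' = j then 1 else 0) := by
      intro j'
      rw [← hUR j' j, Finset.mul_sum]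
      exact Finset.sum_congr rfl fun i _ => by ring
    have e1 : ∑ i : Fin 5, y i * R i (piv j) = c (piv j) := by
      simp_rw [hy, Finset.sum_mul]
      rw [Finset.sum_comm, Finset.sum_congr rfl fun j' _ => e1' j']
      simp only [mul_ite, mul_one, mul_zero, Finset.sum_ite_eq', Finset.mem_univ, if_true]
    rw [hw, e1, sub_self]
  have hswap : ∀ t : Fin 10, ∑ r : Fin 15, hodgeVec (tau t) (rep r) * ∑ i : Fin 5, y i * R i r =
      ∑ i : Fin 5, y i * ∑ r : Fin 15, hodgeVec (tau t) (rep r) * R i r := by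
    intro t
    simp_rw [Finset.mul_sum]
    rw [Finset.sum_comm]
    exact Finset.sum_congr rfl fun i _ => Finset.sum_congr rfl fun r _ => by ring
  have hw_form : ∀ t : Fin 10, ∑ r : Fin 15, hodgeVec (tau t) (rep r) * w r = 0 := by
    intro t
    simp_rw [hw, mul_sub]
    rw [Finset.sum_sub_distrib, hform t, hswap t]
    simp [hMR]
  have hw_np : ∀ a : Fin 10, w (nonpiv a) = 0 := by
    intro a
    have e2 : ∑ t : Fin 10, adj a t * ∑ r : Fin 15, hodgeVec (tau t) (rep r) * w r =
        ∑ r : Fin 15, (∑ t : Fin 10, adj a t * hodgeVec (tau t) (rep r)) * w r := by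
      simp_rw [Finset.mul_sum, Finset.sum_mul]
      rw [Finset.sum_comm]
      exact Finset.sum_congr rfl fun r _ => Finset.sum_congr rfl fun t _ => by ring
    have e3 : ∀ r : Fin 15, (∑ t : Fin 10, adj a t * hodgeVec (tau t) (rep r)) * w r = if r = nonpiv a then 512 * w r else 0 := by
      intro r
      rcases hpart r with ⟨j, rfl⟩ | ⟨b, rfl⟩
      · rw [hw_piv j, mul_zero, if_neg (hdisj j a)]
      · rw [hadj a b]
        by_cases hab : a = b
        · subst hab
          simp
        · rw [if_neg hab, zero_mul, if_neg (fun h => hab (hinj b a h).symm)]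
    have h512 : ∑ t : Fin 10, adj a t * ∑ r : Fin 15, hodgeVec (tau t) (rep r) * w r = 512 * w (nonpiv a) := by
      rw [e2, Finset.sum_congr rfl fun r _ => e3 r]
      simp only [Finset.sum_ite_eq', Finset.mem_univ, if_true]
    have h0 : ∑ t : Fin 10, adj a t * ∑ r : Fin 15, hodgeVec (tau t) (rep r) * w r = 0 := by
      simp [hw_form]
    rw [h0] at h512
    omega
  have hc : ∀ r : Fin 15, c r = ∑ i : Fin 5, y i * R i r := by
    intro r
    have h0 : w r = 0 := by
      rcases hpart r with ⟨j, rfl⟩ | ⟨b, rfl⟩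
      · exact hw_piv j
      · exact hw_np b
    rw [hw] at h0
    exact sub_eq_zero.mp h0
  -- `v = Σ_i y_i • rowV i`, compared label by label
  obtain ⟨hrep, -, hexist, hisr, hinjr, -, -⟩ := rowV_spec
  have hv : (∑ r : Fin 15, c r • ind {rep r}) = ∑ i : Fin 5, y i • rowV i := by
    funext z
    rw [Finset.sum_apply, Finset.sum_apply]
    simp only [Pi.smul_apply, smul_eq_mul, ind, Finset.mem_singleton, mul_ite, mul_one, mul_zero]
    by_cases hz : isRep z = true
    · obtain ⟨r₀, rfl⟩ := hexist z hz
      rw [Finset.sum_eq_single r₀ (fun r _ hr => if_neg (fun h => hr (hinjr r₀ r h).symm)) (fun h => absurd (Finset.mem_univ _) h),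
        if_pos rfl, hc r₀]
      simp_rw [hrep]
    · have hz' : isRep z = false := by simpa using hz
      have h1 : ∀ r : Fin 15, (if z = rep r then c r else 0) = 0 := fun r => if_neg (fun h => hz (by rw [h]; exact hisr r))
      have h2 : ∀ i : Fin 5, rowV i z = 0 := fun i => rowV_eq_zero i hz'
      simp_rw [h1, h2, mul_zero, Finset.sum_const_zero]
  rw [hv]
  exact Submodule.sum_mem _ fun i _ => Submodule.smul_mem _ _ (rowV_mem i)

/-! ## The lattice theorem -/

/-- **LATTICE THEOREM (`D₁₀`).**  The Hodge lattice of the whole `F`-slice of a dihedral CM field of degree `20` is generated by the divisor classes and the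
Galois translates of the sixty-six rank-four face monomials `orbitRep`: `H = P ⊔ A` (`A` spelled out).  With `sixtysix_le_card_of_generates`
(`Census/IcosicDihedralMinimality.lean`): `μ(D₁₀) = 66`, attained by faces. [folklore] -/
theorem lattice_theorem_icosic_dihedral :
    hodgeLattice = pairs ⊔ Submodule.span ℤ (Set.range fun p : G × Fin 66 => transl p.1 (atomVec p.2)) := by
  refine le_antisymm ?_ (sup_le pairs_le atoms_le)
  intro v hv
  show v ∈ pairs ⊔ atoms
  have hPA : pairs ⊔ atoms ≤ hodgeLattice := sup_le pairs_le atoms_le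
  have hWle : W ≤ XR ⊔ (pairs ⊔ atoms) := by
    rw [W]
    exact sup_le (XL_le.trans (sup_le_sup_left le_sup_left _)) le_sup_right
  obtain ⟨b, hb, w, hw, hbw⟩ := Submodule.mem_sup.mp (hWle (mem_W v))
  have hbH : b ∈ hodgeLattice := by
    have e : b = v - w := eq_sub_of_add_eq hbw
    rw [e]
    exact Submodule.sub_mem _ hv (hPA hw)
  rw [← hbw]
  exact Submodule.add_mem _ (hodge_inf_XR_le hbH hb) hw

/-- **`μ(D₁₀) ≤ 66` in the form used by the minimality statement**: the Hodge lattice is generated, modulo pairs, by the translates of the finite family of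
the `66` face monomials. [folklore] -/
theorem hodgeLattice_le_span_faces_dihedral :
    hodgeLattice ≤ pairs ⊔ Submodule.span ℤ {v | ∃ g : G, ∃ u ∈ (univ.image atomVec : Finset (Pt → ℤ)), v = transl g u} := by
  rw [lattice_theorem_icosic_dihedral]
  refine sup_le_sup_left (Submodule.span_le.mpr ?_) _
  rintro _ ⟨p, rfl⟩
  exact Submodule.subset_span ⟨p.1, atomVec p.2, Finset.mem_image_of_mem _ (Finset.mem_univ _), rfl⟩

/-- **DEFICIENCY `μ(D₁₀) = 66`, attained by rank-four faces.**  The family of the `66` face monomials generates the Hodge lattice modulo pairs under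
translation and has at most `66` members, and every generating family has at least `66` members: `66 = 68 − 2 = dim_{𝔽₂}(H/P ⊗ 𝔽₂)_G`, the split value of the
lane's law. [folklore] -/
theorem deficiency_sixtysix_dihedral :
    (hodgeLattice ≤ pairs ⊔ Submodule.span ℤ {v | ∃ g : G, ∃ u ∈ (univ.image atomVec : Finset (Pt → ℤ)), v = transl g u} ∧
      (univ.image atomVec : Finset (Pt → ℤ)).card ≤ 66) ∧
    ∀ S : Finset (Pt → ℤ), hodgeLattice ≤ pairs ⊔ Submodule.span ℤ {v | ∃ g : G, ∃ u ∈ S, v = transl g u} → 66 ≤ S.card :=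
  ⟨⟨hodgeLattice_le_span_faces_dihedral, Finset.card_image_le.trans (by simp)⟩, sixtysix_le_card_of_generates⟩

end Summit.HodgeConjecture.CorCM.Census.IcosicDihedralSpecies
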